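import Mathlib
import Literature.Topology.PlaneTopology.CrosscutProofs
import Literature.Topology.PlaneTopology.ArcLoops

/-!
# The two sides of a cross-cut of a Jordan domain, as Jordan domains

Support file for item `stmt-CriticalPhenomena-4984` (`AvoidancePassage`, routes
`SAWLoopFugacityFlow` / `SAWSteinDefect`): the outer approximation of a hull subdomain by carved
super-domains is a cut-and-paste argument with Jordan domains, and this file supplies the basic
brick.

* `exists_sides` — Newman's cross-cut theorem (`Newman1939_crosscut_holds`, PROVED in the tree)
  between two ARBITRARY distinct frontier points `a`, `b` of a Jordan domain `D` (the named fact is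
  stated for `a = boundary s`, `b = boundary t`, `s < t < s + 1`; here the parameters are found and
  ordered): `D ∖ L = U₁ ⊔ U₂` with `∂Uᵢ = L ∪ Aᵢ`, `A₁`, `A₂` the two simple arcs of `∂D` from `a`
  to `b`, `A₁ ∪ A₂ = ∂D`, `A₁ ∩ A₂ = {a, b}`.
* `exists_jordanDomain_of_frontier_eq` — a side `U` (open, connected, `⊆ D`, `∂U = L ∪ A`) IS a
  Jordan domain whose boundary loop runs through `A` on `[0, ½]` (from `a` to `b`) and back through
  `L` on `[½, 1]` (`concatPath`, `ArcLoops`).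
* `exists_jordan_sides` — both packaged together.

All folklore (Newman 1939, Ch. V §11). No new definitions.
-/

noncomputable section

namespace Summit.CriticalPhenomena.SAWScalingLimit.Theorems.AvoidancePassage

open Set Metric Filter Topology
open Literature.Topology.PlaneTopology
open Literature.Probability.RandomPlanarGeometry (JordanDomain)

/-! ### Newman's theorem between arbitrary frontier points -/

/-- Two distinct frontier points of a Jordan domain have parameters `s < t < s + 1` (in one of
the two orders). [folklore] -/
theorem exists_params_of_mem_frontier (D : JordanDomain) {a b : ℂ} (ha : a ∈ frontier D.carrier)
    (hb : b ∈ frontier D.carrier) (hab : a ≠ b) :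
    ∃ s t : ℝ, s < t ∧ t < s + 1 ∧
      ((D.boundary s = a ∧ D.boundary t = b) ∨ (D.boundary s = b ∧ D.boundary t = a)) := by
  rw [D.frontier_eq_image_Ico] at ha hb
  obtain ⟨u, hu, rfl⟩ := ha
  obtain ⟨v, hv, rfl⟩ := hb
  rcases lt_trichotomy u v with h | rfl | h
  · exact ⟨u, v, h, by linarith [hu.1, hv.2], Or.inl ⟨rfl, rfl⟩⟩
  · exact absurd rfl hab
  · exact ⟨v, u, h, by linarith [hv.1, hu.2], Or.inr ⟨rfl, rfl⟩⟩

/-- A simple arc in `D̄` whose interior lies in `D` meets `∂D` only at its end-points.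
[folklore] -/
theorem inter_frontier_subset_pair (D : JordanDomain) {L : Set ℂ} {a b : ℂ}
    (hLD : L \ {a, b} ⊆ D.carrier) : L ∩ frontier D.carrier ⊆ {a, b} := by
  intro z hz
  by_contra h
  exact Set.disjoint_left.1 D.disjoint_carrier_frontier (hLD ⟨hz.1, h⟩) hz.2

/-- Newman's theorem for a cross-cut from `boundary s` to `boundary t`, `s < t < s + 1`, with the
two boundary arcs made explicit as simple arcs from `boundary s` to `boundary t`.
[cite: Newman1939, Ch. V §11, Thms. 11·7 and 11·8, pp. 94–95] -/
theorem exists_sides_aux (D : JordanDomain) {L : Set ℂ} {s t : ℝ} (hst : s < t) (hts : t < s + 1)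
    (hL : IsSimpleArc L (D.boundary s) (D.boundary t))
    (hLD : L \ {D.boundary s, D.boundary t} ⊆ D.carrier) :
    ∃ U₁ U₂ A₁ A₂ : Set ℂ, IsOpen U₁ ∧ IsOpen U₂ ∧ IsConnected U₁ ∧ IsConnected U₂ ∧
      Disjoint U₁ U₂ ∧ U₁ ∪ U₂ = D.carrier \ L ∧ frontier U₁ = L ∪ A₁ ∧ frontier U₂ = L ∪ A₂ ∧
      IsSimpleArc A₁ (D.boundary s) (D.boundary t) ∧ IsSimpleArc A₂ (D.boundary s) (D.boundary t) ∧
      A₁ ∪ A₂ = frontier D.carrier ∧ A₁ ∩ A₂ = {D.boundary s, D.boundary t} := by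
  have hcut : D.IsCrosscut L (D.boundary s) (D.boundary t) :=
    ⟨hL, D.boundary_mem_frontier s, D.boundary_mem_frontier t, hL.ne, hLD⟩
  obtain ⟨U₁, U₂, h1o, h2o, h1c, h2c, hdisj, hunion, hf1, hf2⟩ :=
    Newman1939_crosscut_holds D L s t hst hts hcut
  refine ⟨U₁, U₂, D.boundary '' Icc s t, D.boundary '' Icc t (s + 1), h1o, h2o, h1c, h2c, hdisj,
    hunion, hf1, hf2, D.isSimpleArc_image_boundary hst hts, ?_,
    (D.frontier_eq_union_image_boundary s t).symm, ?_⟩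
  · have h := (D.isSimpleArc_image_boundary (s := t) (t := s + 1) hts (by linarith)).symm
    rwa [D.periodic_boundary] at h
  · apply Subset.antisymm (D.image_boundary_inter_subset hst hts)
    rintro z (rfl | rfl)
    · exact ⟨⟨s, left_mem_Icc.2 hst.le, rfl⟩, ⟨s + 1, right_mem_Icc.2 hts.le, D.periodic_boundary s⟩⟩
    · exact ⟨⟨t, right_mem_Icc.2 hst.le, rfl⟩, ⟨t, left_mem_Icc.2 hts.le, rfl⟩⟩

/-- **Newman's cross-cut theorem between arbitrary frontier points.** If `L` is a simple arc from
`a` to `b`, two distinct points of `∂D`, with all other points in `D`, then `D ∖ L = U₁ ⊔ U₂` for two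
domains with `∂Uᵢ = L ∪ Aᵢ`, where `A₁`, `A₂` are the two arcs of `∂D` from `a` to `b`
(`A₁ ∪ A₂ = ∂D`, `A₁ ∩ A₂ = {a, b}`).
[cite: Newman1939, Ch. V §11, Thms. 11·7 and 11·8, pp. 94–95] -/
theorem exists_sides (D : JordanDomain) {L : Set ℂ} {a b : ℂ} (hL : IsSimpleArc L a b)
    (ha : a ∈ frontier D.carrier) (hb : b ∈ frontier D.carrier) (hLD : L \ {a, b} ⊆ D.carrier) :
    ∃ U₁ U₂ A₁ A₂ : Set ℂ, IsOpen U₁ ∧ IsOpen U₂ ∧ IsConnected U₁ ∧ IsConnected U₂ ∧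
      Disjoint U₁ U₂ ∧ U₁ ∪ U₂ = D.carrier \ L ∧ frontier U₁ = L ∪ A₁ ∧ frontier U₂ = L ∪ A₂ ∧
      IsSimpleArc A₁ a b ∧ IsSimpleArc A₂ a b ∧ A₁ ∪ A₂ = frontier D.carrier ∧
      A₁ ∩ A₂ = {a, b} := by
  obtain ⟨s, t, hst, hts, h⟩ := exists_params_of_mem_frontier D ha hb hL.ne
  rcases h with ⟨rfl, rfl⟩ | ⟨rfl, rfl⟩
  · exact exists_sides_aux D hst hts hL hLD
  · have hLD' : L \ {D.boundary s, D.boundary t} ⊆ D.carrier := by rwa [Set.pair_comm]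
    obtain ⟨U₁, U₂, A₁, A₂, h1o, h2o, h1c, h2c, hdisj, hunion, hf1, hf2, hA1, hA2, hAu, hAi⟩ :=
      exists_sides_aux D hst hts hL.symm hLD'
    exact ⟨U₁, U₂, A₁, A₂, h1o, h2o, h1c, h2c, hdisj, hunion, hf1, hf2, hA1.symm, hA2.symm, hAu,
      by rw [hAi, Set.pair_comm]⟩

/-! ### A side of a cross-cut is a Jordan domain -/

/-- **A side of a cross-cut is a Jordan domain.** Let `L` be a simple arc from `a` to `b` with
interior in the Jordan domain `D`, `A ⊆ ∂D` a simple arc from `a` to `b`, and `U ⊆ D` open and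
connected with `∂U = L ∪ A`. Then `U` is the carrier of a Jordan domain whose boundary loop runs
through `A` on `[0, ½]` (from `a` at `0` to `b` at `½`) and back to `a` through `L` on `[½, 1]`.
[folklore] -/
theorem exists_jordanDomain_of_frontier_eq (D : JordanDomain) {L A U : Set ℂ} {a b : ℂ}
    (hL : IsSimpleArc L a b) (hA : IsSimpleArc A a b) (hAF : A ⊆ frontier D.carrier)
    (hLD : L \ {a, b} ⊆ D.carrier) (hUo : IsOpen U) (hUc : IsConnected U) (hUD : U ⊆ D.carrier)
    (hfr : frontier U = L ∪ A) :
    ∃ J : JordanDomain, J.carrier = U ∧ J.boundary 0 = a ∧ J.boundary (1 / 2) = b ∧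
      J.boundary '' Icc 0 (1 / 2) = A ∧ J.boundary '' Icc (1 / 2) 1 = L := by
  obtain ⟨γ₁, hγ₁, hi₁, hA₁, h0₁, h1₁⟩ := isSimpleArc_iff_continuous.1 hA
  obtain ⟨γ₂, hγ₂, hi₂, hL₂, h0₂, h1₂⟩ := isSimpleArc_iff_continuous.1 hL.symm
  have hmeet : γ₁ '' Icc 0 1 ∩ γ₂ '' Icc 0 1 ⊆ {γ₁ 1, γ₁ 0} := by
    rw [hA₁, hL₂, h1₁, h0₁]
    rintro z ⟨hzA, hzL⟩
    have hz : z ∈ ({a, b} : Set ℂ) := inter_frontier_subset_pair D hLD ⟨hzL, hAF hzA⟩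
    rcases hz with rfl | rfl
    · exact Or.inr rfl
    · exact Or.inl rfl
  have hj : γ₁ 1 = γ₂ 0 := by rw [h1₁, h0₂]
  have hj' : γ₂ 1 = γ₁ 0 := by rw [h1₂, h0₁]
  have h01 : concatPath γ₁ γ₂ 0 = concatPath γ₁ γ₂ 1 := by
    rw [concatPath_zero, concatPath_one, hj']
  refine ⟨{ carrier := U
            boundary := concatPath γ₁ γ₂ ∘ Int.fract
            isOpen := hUo
            isBounded := D.isBounded.subset hUD
            isConnected := hUc
            continuous_boundary :=
              (continuous_concatPath hγ₁ hγ₂ hj).continuousOn.comp_fract'' h01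
            periodic_boundary := periodic_comp_fract
            injOn_boundary := injOn_comp_fract (injOn_concatPath_Ico hi₁ hi₂ hj hj' hmeet)
            range_boundary := by
              rw [range_comp_fract h01, image_concatPath_Icc_zero_one hj, hA₁, hL₂, hfr,
                union_comm] }, rfl, ?_, ?_, ?_, ?_⟩
  · show (concatPath γ₁ γ₂ ∘ Int.fract) 0 = a
    simp [h0₁]
  · show (concatPath γ₁ γ₂ ∘ Int.fract) (1 / 2) = b
    rw [comp_fract_apply_of_mem_Icc h01 (by norm_num), concatPath_half, h1₁]
  · show (concatPath γ₁ γ₂ ∘ Int.fract) '' Icc 0 (1 / 2) = A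
    rw [image_comp_fract_Icc h01 le_rfl (by norm_num), image_concatPath_Icc_zero_half, hA₁]
  · show (concatPath γ₁ γ₂ ∘ Int.fract) '' Icc (1 / 2) 1 = L
    rw [image_comp_fract_Icc h01 (by norm_num) le_rfl, image_concatPath_Icc_half_one hj, hL₂]

/-- **The two sides of a cross-cut, as Jordan domains.** For a simple arc `L` from `a` to `b`
(distinct points of `∂D`) with interior in `D`: `D ∖ L = J₁ ⊔ J₂` for two Jordan domains with
`∂Jᵢ = L ∪ Aᵢ` (`A₁ ∪ A₂ = ∂D`, `A₁ ∩ A₂ = {a, b}`), whose boundary loops run through `Aᵢ` on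
`[0, ½]` and through `L` on `[½, 1]`, with `a` at parameter `0` and `b` at `½`.
[cite: Newman1939, Ch. V §11, Thms. 11·7 and 11·8, pp. 94–95] -/
theorem exists_jordan_sides (D : JordanDomain) {L : Set ℂ} {a b : ℂ} (hL : IsSimpleArc L a b)
    (ha : a ∈ frontier D.carrier) (hb : b ∈ frontier D.carrier) (hLD : L \ {a, b} ⊆ D.carrier) :
    ∃ (J₁ J₂ : JordanDomain) (A₁ A₂ : Set ℂ),
      Disjoint J₁.carrier J₂.carrier ∧ J₁.carrier ∪ J₂.carrier = D.carrier \ L ∧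
      frontier J₁.carrier = L ∪ A₁ ∧ frontier J₂.carrier = L ∪ A₂ ∧
      IsSimpleArc A₁ a b ∧ IsSimpleArc A₂ a b ∧ A₁ ∪ A₂ = frontier D.carrier ∧
      A₁ ∩ A₂ = {a, b} ∧
      (J₁.boundary 0 = a ∧ J₁.boundary (1 / 2) = b ∧ J₁.boundary '' Icc 0 (1 / 2) = A₁ ∧
        J₁.boundary '' Icc (1 / 2) 1 = L) ∧
      (J₂.boundary 0 = a ∧ J₂.boundary (1 / 2) = b ∧ J₂.boundary '' Icc 0 (1 / 2) = A₂ ∧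
        J₂.boundary '' Icc (1 / 2) 1 = L) := by
  obtain ⟨U₁, U₂, A₁, A₂, h1o, h2o, h1c, h2c, hdisj, hunion, hf1, hf2, hA1, hA2, hAu, hAi⟩ :=
    exists_sides D hL ha hb hLD
  have hA1F : A₁ ⊆ frontier D.carrier := hAu ▸ subset_union_left
  have hA2F : A₂ ⊆ frontier D.carrier := hAu ▸ subset_union_right
  have hU1D : U₁ ⊆ D.carrier := fun z hz ↦ ((hunion ▸ Or.inl hz : z ∈ D.carrier \ L)).1
  have hU2D : U₂ ⊆ D.carrier := fun z hz ↦ ((hunion ▸ Or.inr hz : z ∈ D.carrier \ L)).1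
  obtain ⟨J₁, hJ₁, hJ₁'⟩ := exists_jordanDomain_of_frontier_eq D hL hA1 hA1F hLD h1o h1c hU1D hf1
  obtain ⟨J₂, hJ₂, hJ₂'⟩ := exists_jordanDomain_of_frontier_eq D hL hA2 hA2F hLD h2o h2c hU2D hf2
  subst hJ₁ hJ₂
  exact ⟨J₁, J₂, A₁, A₂, hdisj, hunion, hf1, hf2, hA1, hA2, hAu, hAi, hJ₁', hJ₂'⟩

/-! ### Elementary consequences -/

/-- A preconnected subset of `D ∖ L` lies in one of the two sides. [folklore] -/
theorem subset_or_subset_of_sides {D : JordanDomain} {L U₁ U₂ S : Set ℂ} (h1o : IsOpen U₁)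
    (h2o : IsOpen U₂) (hdisj : Disjoint U₁ U₂) (hunion : U₁ ∪ U₂ = D.carrier \ L)
    (hS : IsPreconnected S) (hSD : S ⊆ D.carrier \ L) : S ⊆ U₁ ∨ S ⊆ U₂ :=
  hS.subset_or_subset h1o h2o hdisj (hunion.symm ▸ hSD)

end Summit.CriticalPhenomena.SAWScalingLimit.Theorems.AvoidancePassage

end
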